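import Literature.Probability.LatticeModels.IsingFKG
import Literature.Probability.LatticeModels.IsingNestedConditioning
import HarnessLib

/-!
# Decreasing events in a sub-region with `+` spins on the rest of the volume: the FKG extension device

Topic `Literature/Probability/LatticeModels`. The comparison behind Kemppainen–Smirnov's remark
that, for models with positive association, crossing bounds against the boundary condition only
need to be proved in *regular* shapes (Ann. Probab. 45 (2017), Rem. 2.10 and §4.1.6, where it is
carried out for the FK model with the FKG inequality "for the decreasing event `{E₂' ⊂ ω'}`";
the spin case is CDHKS 2014, Rem. 4). For finite volumes `Q ⊆ W` of a locally finite graph, a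
boundary condition `η` equal to `+1` on `W ∖ Q` and to `ζ` off `W`, and a *decreasing* event `E`:

* `isingMeasure_real_inter_le_mul_of_isLowerSet_of_isUpperSet` — FKG for events
  (`ising_fkg_holds`): `μ(E ∩ P) ≤ μ(E) μ(P)` for `E` decreasing and `P` increasing;
* `isingMeasure_fixed_real_le_of_plus_on_sdiff` — **`μ^{η}_{Q;β,h}(E) ≤ μ^{ζ}_{W;β,h}(E)`**
  (`β ≥ 0`): by consistency (`lintegral_isingMeasure_fixed_consistent`),
  `μ^ζ_W(E ∩ {σ = +1 on W ∖ Q}) = μ^η_Q(E) · μ^ζ_W(σ = +1 on W ∖ Q)`, and the left-hand side is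
  at most `μ^ζ_W(E) μ^ζ_W(σ = +1 on W ∖ Q)` by FKG.

So the probability of a `−` crossing of any sub-region `Q` of an annulus `W` whose neighbours
in `W` all carry `+` is at most the probability of a `−` crossing of the whole annulus under the
same outer boundary condition — which the RSW bound of `IsingAnnulusCircuit.lean` controls
uniformly. Everything here is proved.

## References

* A. Kemppainen, S. Smirnov, Ann. Probab. 45 (2017), Rem. 2.10, §4.1.6 — `KemppainenSmirnov2017`.
* S. Friedli, Y. Velenik, *Statistical Mechanics of Lattice Systems* (2017), Thm. 3.21 (FKG),
  Lemma 6.7 (consistency) — `FriedliVelenik2017`.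
-/

noncomputable section

namespace Literature.Probability.LatticeModels

open MeasureTheory Finset
open scoped ENNReal

variable {V : Type*} (G : SimpleGraph V) [DecidableEq V] [G.LocallyFinite]

/-- **FKG for events**: under any finite-volume Ising measure with `β ≥ 0`, a decreasing event
and an increasing event are negatively correlated, `μ(E ∩ P) ≤ μ(E) μ(P)` (Friedli–Velenik 2017,
Thm. 3.21, applied to `1 - 1_E` and `1_P`). [cite: FriedliVelenik2017, Thm. 3.21] -/
theorem isingMeasure_real_inter_le_mul_of_isLowerSet_of_isUpperSet {β : ℝ} (hβ : 0 ≤ β)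
    (Λ : Finset V) (h : ℝ) (bc : BoundaryCondition V) {E P : Set (SpinConfig V)}
    (hE : IsLowerSet E) (hP : IsUpperSet P) (hEm : MeasurableSet E) (hPm : MeasurableSet P) :
    (isingMeasure G Λ β h bc).real (E ∩ P) ≤
      (isingMeasure G Λ β h bc).real E * (isingMeasure G Λ β h bc).real P := by
  set μ := isingMeasure G Λ β h bc with hμ
  set f : SpinConfig V → ℝ := fun σ ↦ 1 - E.indicator 1 σ with hf
  set g : SpinConfig V → ℝ := P.indicator 1 with hg
  have hfmono : Monotone f := by
    intro σ₁ σ₂ hle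
    simp only [hf]
    by_cases h₂ : σ₂ ∈ E
    · rw [Set.indicator_of_mem h₂, Set.indicator_of_mem (hE hle h₂)]
      exact le_rfl
    · rw [Set.indicator_of_notMem h₂]
      have h1 : 0 ≤ E.indicator (1 : SpinConfig V → ℝ) σ₁ := Set.indicator_nonneg (fun _ _ ↦ zero_le_one) _
      linarith
  have hgmono : Monotone g := by
    intro σ₁ σ₂ hle
    simp only [hg]
    by_cases h₁ : σ₁ ∈ P
    · rw [Set.indicator_of_mem h₁, Set.indicator_of_mem (hP hle h₁)]
      exact le_rfl
    · rw [Set.indicator_of_notMem h₁]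
      exact Set.indicator_nonneg (fun _ _ ↦ zero_le_one) _
  have hfm : Measurable f := measurable_const.sub (measurable_const.indicator hEm)
  have hgm : Measurable g := measurable_const.indicator hPm
  have key := ising_fkg_holds G hβ Λ h bc f g hfmono hgmono hfm hgm
  have hfg : f * g = fun σ ↦ P.indicator 1 σ - (E ∩ P).indicator 1 σ := by
    funext σ
    simp only [Pi.mul_apply, hf, hg]
    rw [Set.inter_comm, ← Set.indicator_indicator]
    by_cases hσ : σ ∈ P
    · simp [Set.indicator_of_mem hσ]
    · simp [Set.indicator_of_notMem hσ]
  have hIf : isingExpect G Λ β h bc f = 1 - μ.real E := by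
    rw [hμ, isingExpect, integral_sub (integrable_const _) ((integrable_const _).indicator hEm),
      integral_const, integral_indicator_one hEm]
    simp
  have hIg : isingExpect G Λ β h bc g = μ.real P := by
    rw [hμ, isingExpect, hg, integral_indicator_one hPm]
  have hIfg : isingExpect G Λ β h bc (f * g) = μ.real P - μ.real (E ∩ P) := by
    rw [hμ, isingExpect, hfg, integral_sub ((integrable_const _).indicator hPm)
      ((integrable_const _).indicator (hEm.inter hPm)), integral_indicator_one hPm,
      integral_indicator_one (hEm.inter hPm)]
  rw [hIf, hIg, hIfg] at key
  nlinarith [key]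

omit [DecidableEq V] [G.LocallyFinite] in
/-- The event "all spins of `S` are `+1`" is increasing and measurable. [folklore] -/
theorem isUpperSet_forall_mem_eq_one (S : Finset V) :
    IsUpperSet {σ : SpinConfig V | ∀ x ∈ S, σ x = 1} := by
  intro σ₁ σ₂ hle h x hx
  have h2 : σ₁ x ≤ σ₂ x := hle x
  rw [h x hx] at h2
  rcases Int.units_eq_one_or (σ₂ x) with h' | h'
  · exact h'
  · rw [h'] at h2; exact absurd h2 (by decide)

omit [DecidableEq V] [G.LocallyFinite] in
/-- See `isUpperSet_forall_mem_eq_one`. [folklore] -/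
theorem measurableSet_forall_mem_eq_one (S : Finset V) :
    MeasurableSet {σ : SpinConfig V | ∀ x ∈ S, σ x = 1} := by
  have : {σ : SpinConfig V | ∀ x ∈ S, σ x = 1} = ⋂ x ∈ S, (fun σ : SpinConfig V ↦ σ x) ⁻¹' {1} := by
    ext σ; simp
  rw [this]
  exact MeasurableSet.biInter S.countable_toSet fun x _ ↦ (measurable_pi_apply x) (measurableSet_singleton 1)

/-- **The FKG extension device** (Kemppainen–Smirnov 2017, Rem. 2.10 / §4.1.6 pattern, for the
Ising model): let `Q ⊆ W` be finite volumes of a locally finite graph with countable vertex set,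
`β ≥ 0`, and let the boundary condition `η` be `+1` on `W ∖ Q` and agree with `ζ` off `W`. Then
for every decreasing measurable event `E`, `μ^{η}_{Q;β,h}(E) ≤ μ^{ζ}_{W;β,h}(E)`: conditioning
`μ^ζ_W` on the increasing event `{σ = +1 on W ∖ Q}` produces `μ^η_Q` (consistency), and FKG
bounds the conditional probability of the decreasing `E` by the unconditional one.
[cite: KemppainenSmirnov2017, Rem. 2.10] -/
theorem isingMeasure_fixed_real_le_of_plus_on_sdiff [Countable V] {β : ℝ} (hβ : 0 ≤ β) (h : ℝ)
    {Q W : Finset V} (hQW : Q ⊆ W) {η ζ : SpinConfig V} (hηW : ∀ x ∈ W, x ∉ Q → η x = 1)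
    (hagree : ∀ x ∉ W, η x = ζ x) {E : Set (SpinConfig V)} (hE : IsLowerSet E)
    (hEm : MeasurableSet E) :
    (isingMeasure G Q β h (.fixed η)).real E ≤ (isingMeasure G W β h (.fixed ζ)).real E := by
  classical
  set P : Set (SpinConfig V) := {σ | ∀ x ∈ W \ Q, σ x = 1} with hP
  have hPup : IsUpperSet P := isUpperSet_forall_mem_eq_one (W \ Q)
  have hPm : MeasurableSet P := measurableSet_forall_mem_eq_one (W \ Q)
  have hPdet : ∀ σ₁ σ₂ : SpinConfig V, (∀ x ∉ Q, σ₁ x = σ₂ x) → (σ₁ ∈ P ↔ σ₂ ∈ P) := by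
    intro σ₁ σ₂ hσ
    simp only [hP, Set.mem_setOf_eq]
    refine forall₂_congr fun x hx ↦ ?_
    rw [hσ x (Finset.mem_sdiff.1 hx).2]
  set μW := isingMeasure G W β h (.fixed ζ) with hμW
  set μQ := isingMeasure G Q β h (.fixed η) with hμQ
  -- consistency: `μ_W(E ∩ P) = μ_Q(E) μ_W(P)`
  have hcons : μW (E ∩ P) = μQ E * μW P := by
    rw [hμW, ← lintegral_isingMeasure_fixed_consistent G hQW β h ζ (hEm.inter hPm)]
    simp_rw [isingMeasure_fixed_inter_of_determined_off G Q β h _ hEm hPm hPdet]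
    have hae := ae_eqOn_compl_isingMeasure_fixed G W β h ζ
    have heq : ∀ᵐ σ ∂isingMeasure G W β h (.fixed ζ),
        P.indicator (fun _ ↦ isingMeasure G Q β h (.fixed σ) E) σ = P.indicator (fun _ ↦ μQ E) σ := by
      filter_upwards [hae] with σ hσ
      by_cases hσP : σ ∈ P
      · rw [Set.indicator_of_mem hσP, Set.indicator_of_mem hσP, hμQ]
        refine isingMeasure_fixed_congr_of_eqOn_compl G Q β h (fun x hx ↦ ?_) hEm
        by_cases hxW : x ∈ W
        · rw [hσP x (Finset.mem_sdiff.2 ⟨hxW, hx⟩), hηW x hxW hx]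
        · rw [hσ x hxW, hagree x hxW]
      · rw [Set.indicator_of_notMem hσP, Set.indicator_of_notMem hσP]
    rw [lintegral_congr_ae heq, lintegral_indicator hPm, setLIntegral_const]
  -- positivity of `μ_W(P)`
  have hPpos : 0 < μW.real P := by
    have hmem : glue W (fun _ ↦ 1) (.fixed ζ) ∈ P := fun x hx ↦ by
      rw [glue_apply_of_mem _ _ _ (Finset.mem_sdiff.1 hx).1]
    have hsing := isingMeasure_apply_singleton_holds G W β h (.fixed ζ) (fun _ ↦ 1)
    have hpos : 0 < μW.real {glue W (fun _ ↦ 1) (.fixed ζ)} := by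
      rw [measureReal_def, hμW, hsing, ENNReal.toReal_ofReal (div_nonneg (isingWeight_pos G W β h _ _).le
        (isingPartitionFunction_pos G W β h _).le)]
      exact div_pos (isingWeight_pos G W β h _ _) (isingPartitionFunction_pos G W β h _)
    exact hpos.trans_le (measureReal_mono (Set.singleton_subset_iff.2 hmem))
  -- FKG and division
  have hfkg := isingMeasure_real_inter_le_mul_of_isLowerSet_of_isUpperSet G hβ W h (.fixed ζ) hE hPup hEm hPm
  have hreal : μW.real (E ∩ P) = μQ.real E * μW.real P := by
    rw [measureReal_def, hcons, ENNReal.toReal_mul, ← measureReal_def, ← measureReal_def]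
  rw [hreal] at hfkg
  exact le_of_mul_le_mul_right hfkg hPpos

end Literature.Probability.LatticeModels

end
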